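import Summits.CriticalPhenomena.PercolationContinuityZ3.Theorems.PercNearOneGluingNoHeavyLowerTailSunflowerAndrasfaiArc
import HarnessLib

/-!
# `NoHeavyLowerTail` (crux stmt-CriticalPhenomena-4575), abstract sunflower cubic: the ANDRÁSFAI GRAPHS ARE A-SAFE, part 2a — windows, petal and crossing weights, FACT 1 / FACT 2, connectivity of windows, the run lemma

Support file (seat `prim-ineq-prove-1` gen 42; `--supports stmt-CriticalPhenomena-4575`).  No `sorry`, no named facts, standard axioms.
Memo: run/shared/lean/prim/prim-ineq-prove-1/FINDING-BLOWUP-prove1-g42.md §7 (the theorem and its proof).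

THE PROGRAMME (files `…SunflowerAndrasfai*`).  THEOREM (memo §7; `Arc.arcGraph_safe` in `…SunflowerAndrasfaiSafe`): for every `k`
the graph core of the Andrásfai graph (`arcGraph k` on `Fin (3k+2)`: adjacent iff in no common arc of `k+1` consecutive points) is
safe for every product measure — conjecture (And) of `…SunflowerAndrasfai`; hence (…SunflowerBlowup, …BlowupHom) so is the core
of every blow-up of an Andrásfai graph and of every maximal triangle-free graph homomorphic to one.  PROOF: polarisation
(`safe_arcGraph_of_colouring_ineq`, part 1b) reduces safety to `∏_j Λ(C_j) ≤ Λ(∅)^(K-1)` for colourings of the arc-starts; this is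
proved by induction on the number of colour changes (part 4): one of two adjacent LIGHT runs `X`, `Y` (`|X|+|Y| ≤ 2k+1`, `|Y| ≤ k`,
part 2b) is recoloured with the other's colour, which does not decrease the product by FACT 1/2 (part 2a) and the INTERVAL MERGING
LEMMA `w(X)·w(Y) ≤ Λ(∅)·z(X,Y)` (part 3: an explicit weight-preserving injection `Φ : W_X × W_Y → A × Z_{XY}`).

THIS FILE.  `U ω` (the window: starts of the arcs containing the row `ω`), the petal weight `wset p C` (rows with non-empty window inside
`C`), the crossing weight `zset p X C`, `lam_eq : Λ p C = Λ p ∅ + wset p C`; FACT 2 `wset_union` (petal weight of `C ∪ X`), FACT 1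
`wset_split` (abstract) with its geometric input `U_subset_run` (a window inside a class that meets a run of the class lies inside
the run — windows are connected, `sh_mem_U_of_fd_le`); cyclic intervals `ivl o lo hi`.
-/

noncomputable section

namespace Summit.CriticalPhenomena.PercolationContinuityZ3.Theorems.SunflowerPartition

namespace SafeCalc

open Finset
open TwoGenCore (wmiss)

namespace Arc

variable {k : ℕ}

/-! ## Windows, petal weights, and the decomposition of `Λ` -/

section Windows

variable (p : Fin (3 * k + 2) → unitInterval)

/-- The WINDOW of a row: the starts of the arcs containing it (empty iff the row is in the core; all starts for `ω = ∅`). [this work] -/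
def U (ω : Finset (Fin (3 * k + 2))) : Finset (Fin (3 * k + 2)) := univ.filter fun t => ω ⊆ arc k t

/-- Membership in the window. -/
@[simp] theorem mem_U {ω : Finset (Fin (3 * k + 2))} {t : Fin (3 * k + 2)} : t ∈ U ω ↔ ω ⊆ arc k t := by simp [U]

/-- The petal weight of a set `C` of starts: rows with a non-empty window inside `C`. [this work] -/
def wset (C : Finset (Fin (3 * k + 2))) : ℝ :=
  ∑ ω ∈ univ.filter (fun ω => (U (k := k) ω).Nonempty ∧ U (k := k) ω ⊆ C), wrow p ω

/-- The crossing weight: rows whose window lies in `X ∪ C` and meets both `X` and `C`. [this work] -/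
def zset (X C : Finset (Fin (3 * k + 2))) : ℝ :=
  ∑ ω ∈ univ.filter (fun ω => U (k := k) ω ⊆ X ∪ C ∧ (U (k := k) ω ∩ X).Nonempty ∧ (U (k := k) ω ∩ C).Nonempty), wrow p ω

/-- `wset` is nonnegative. -/
theorem wset_nonneg (C : Finset (Fin (3 * k + 2))) : 0 ≤ wset p C := sum_nonneg fun ω _ => wrow_nonneg p ω

/-- `zset` is nonnegative. -/
theorem zset_nonneg (X C : Finset (Fin (3 * k + 2))) : 0 ≤ zset p X C := sum_nonneg fun ω _ => wrow_nonneg p ω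

/-- `Λ p C = Λ p ∅ + wset p C`: the rows counted by `Λ p C` are those in the core (empty window) and those with a non-empty window
inside `C`. [this work] -/
theorem lam_eq (C : Finset (Fin (3 * k + 2))) : lam p C = lam p ∅ + wset p C := by
  classical
  unfold lam wset
  have h1 : ∀ ω : Finset (Fin (3 * k + 2)), (wrow p ω * if ∀ t, ω ⊆ arc k t → t ∈ C then 1 else 0) =
      (wrow p ω * if ∀ t, ω ⊆ arc k t → t ∈ (∅ : Finset _) then 1 else 0) +
      (if (U (k := k) ω).Nonempty ∧ U (k := k) ω ⊆ C then wrow p ω else 0) := by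
    intro ω
    by_cases hU : (U (k := k) ω).Nonempty
    · obtain ⟨t0, ht0⟩ := hU
      rw [mem_U] at ht0
      have hne : ¬ ∀ t, ω ⊆ arc k t → t ∈ (∅ : Finset (Fin (3 * k + 2))) := fun h => by simpa using h t0 ht0
      rw [if_neg hne, mul_zero, zero_add]
      by_cases hC : ∀ t, ω ⊆ arc k t → t ∈ C
      · rw [if_pos hC, mul_one, if_pos ⟨⟨t0, mem_U.2 ht0⟩, fun t ht => hC t (mem_U.1 ht)⟩]
      · rw [if_neg hC, mul_zero, if_neg]
        rintro ⟨-, h⟩; exact hC fun t ht => h (mem_U.2 ht)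
    · have hall : ∀ D : Finset (Fin (3 * k + 2)), (∀ t, ω ⊆ arc k t → t ∈ D) := by
        intro D t ht; exact absurd ⟨t, mem_U.2 ht⟩ hU
      rw [if_pos (hall C), if_pos (hall ∅), if_neg (fun h => hU h.1), add_zero]
  rw [sum_congr rfl fun ω _ => h1 ω, sum_add_distrib, sum_filter]

/-- FACT 2: for disjoint `X`, `C` the petal weight of `C ∪ X` splits into the petal weights of `C`, of `X`, and the crossing weight.
[this work] -/
theorem wset_union {X C : Finset (Fin (3 * k + 2))} (hXC : Disjoint X C) :
    wset p (C ∪ X) = wset p C + wset p X + zset p X C := by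
  classical
  unfold wset zset
  rw [sum_filter, sum_filter, sum_filter, sum_filter, ← sum_add_distrib, ← sum_add_distrib]
  refine sum_congr rfl fun ω _ => ?_
  by_cases hsub : U (k := k) ω ⊆ C ∪ X
  · by_cases hX : (U (k := k) ω ∩ X).Nonempty
    · by_cases hC : (U (k := k) ω ∩ C).Nonempty
      · -- meets both
        have h1 : ¬ ((U (k := k) ω).Nonempty ∧ U (k := k) ω ⊆ C) := by
          rintro ⟨-, h⟩; obtain ⟨t, ht⟩ := hX; rw [mem_inter] at ht
          exact Finset.disjoint_left.1 hXC ht.2 (h ht.1)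
        have h2 : ¬ ((U (k := k) ω).Nonempty ∧ U (k := k) ω ⊆ X) := by
          rintro ⟨-, h⟩; obtain ⟨t, ht⟩ := hC; rw [mem_inter] at ht
          exact Finset.disjoint_left.1 hXC (h ht.1) ht.2
        rw [if_pos ⟨hX.mono inter_subset_left, hsub⟩, if_neg h1, if_neg h2,
          if_pos ⟨by rwa [union_comm], hX, hC⟩]; ring
      · -- meets X only: inside X
        have hUX : U (k := k) ω ⊆ X := by
          intro t ht
          rcases mem_union.1 (hsub ht) with h | h
          · exact absurd ⟨t, mem_inter.2 ⟨ht, h⟩⟩ hC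
          · exact h
        have h1 : ¬ ((U (k := k) ω).Nonempty ∧ U (k := k) ω ⊆ C) := by
          rintro ⟨-, h⟩; obtain ⟨t, ht⟩ := hX; rw [mem_inter] at ht
          exact Finset.disjoint_left.1 hXC ht.2 (h ht.1)
        rw [if_pos ⟨hX.mono inter_subset_left, hsub⟩, if_neg h1, if_pos ⟨hX.mono inter_subset_left, hUX⟩,
          if_neg (fun h => hC h.2.2)]; ring
    · by_cases hne : (U (k := k) ω).Nonempty
      · -- inside C
        have hUC : U (k := k) ω ⊆ C := by
          intro t ht
          rcases mem_union.1 (hsub ht) with h | h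
          · exact h
          · exact absurd ⟨t, mem_inter.2 ⟨ht, h⟩⟩ hX
        have h2 : ¬ ((U (k := k) ω).Nonempty ∧ U (k := k) ω ⊆ X) := by
          rintro ⟨-, h⟩; obtain ⟨t, ht⟩ := hne
          exact hX ⟨t, mem_inter.2 ⟨ht, h ht⟩⟩
        rw [if_pos ⟨hne, hsub⟩, if_pos ⟨hne, hUC⟩, if_neg h2, if_neg (fun h => hX h.2.1)]; ring
      · rw [if_neg (fun h => hne h.1), if_neg (fun h => hne h.1), if_neg (fun h => hne h.1),
          if_neg (fun h => hX h.2.1)]; ring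
  · have h0 : ¬ ((U (k := k) ω).Nonempty ∧ U (k := k) ω ⊆ C ∪ X) := fun h => hsub h.2
    have h1 : ¬ ((U (k := k) ω).Nonempty ∧ U (k := k) ω ⊆ C) := fun h => hsub (h.2.trans subset_union_left)
    have h2 : ¬ ((U (k := k) ω).Nonempty ∧ U (k := k) ω ⊆ X) := fun h => hsub (h.2.trans subset_union_right)
    have h3 : ¬ (U (k := k) ω ⊆ X ∪ C ∧ (U (k := k) ω ∩ X).Nonempty ∧ (U (k := k) ω ∩ C).Nonempty) :=
      fun h => hsub (by rw [union_comm]; exact h.1)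
    rw [if_neg h0, if_neg h1, if_neg h2, if_neg h3]; ring

/-- The crossing weight is monotone in the second set (inside a disjointness-free statement: `Y ⊆ C`). [this work] -/
theorem zset_mono {X Y C : Finset (Fin (3 * k + 2))} (hYC : Y ⊆ C) :
    zset p X Y ≤ zset p X C := by
  classical
  unfold zset
  refine sum_le_sum_of_subset_of_nonneg (fun ω hω => ?_) fun ω _ _ => wrow_nonneg p ω
  rw [mem_filter] at hω ⊢
  obtain ⟨-, hsub, hX, hY⟩ := hω
  refine ⟨mem_univ _, hsub.trans (union_subset_union (subset_refl X) hYC), hX, hY.mono ?_⟩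
  exact inter_subset_inter (subset_refl _) hYC

/-- FACT 1 (abstract form): if every window inside `C` that meets `X ⊆ C` lies inside `X`, the petal weight of `C` splits.
[this work] -/
theorem wset_split {X C : Finset (Fin (3 * k + 2))} (hXC : X ⊆ C)
    (hrun : ∀ ω : Finset (Fin (3 * k + 2)), U (k := k) ω ⊆ C → (U (k := k) ω ∩ X).Nonempty → U (k := k) ω ⊆ X) :
    wset p C = wset p X + wset p (C \ X) := by
  classical
  unfold wset
  rw [sum_filter, sum_filter, sum_filter, ← sum_add_distrib]
  refine sum_congr rfl fun ω _ => ?_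
  by_cases h : (U (k := k) ω).Nonempty ∧ U (k := k) ω ⊆ C
  · rw [if_pos h]
    by_cases hX : (U (k := k) ω ∩ X).Nonempty
    · have hUX := hrun ω h.2 hX
      have hn : ¬ ((U (k := k) ω).Nonempty ∧ U (k := k) ω ⊆ C \ X) := by
        rintro ⟨-, h'⟩; obtain ⟨t, ht⟩ := hX; rw [mem_inter] at ht
        exact (mem_sdiff.1 (h' ht.1)).2 ht.2
      rw [if_pos ⟨h.1, hUX⟩, if_neg hn, add_zero]
    · have hUC : U (k := k) ω ⊆ C \ X := fun t ht =>
        mem_sdiff.2 ⟨h.2 ht, fun htX => hX ⟨t, mem_inter.2 ⟨ht, htX⟩⟩⟩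
      have hn : ¬ ((U (k := k) ω).Nonempty ∧ U (k := k) ω ⊆ X) := by
        rintro ⟨hne, h'⟩; obtain ⟨t, ht⟩ := hne; exact hX ⟨t, mem_inter.2 ⟨ht, h' ht⟩⟩
      rw [if_neg hn, if_pos ⟨h.1, hUC⟩, zero_add]
  · rw [if_neg h]
    have h1 : ¬ ((U (k := k) ω).Nonempty ∧ U (k := k) ω ⊆ X) := fun h' => h ⟨h'.1, h'.2.trans hXC⟩
    have h2 : ¬ ((U (k := k) ω).Nonempty ∧ U (k := k) ω ⊆ C \ X) := fun h' => h ⟨h'.1, h'.2.trans sdiff_subset⟩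
    rw [if_neg h1, if_neg h2, add_zero]

end Windows

/-! ## Windows are connected along the cycle of starts -/

/-- Two arcs containing a common point have starts at forward distance `≤ k` one way or the other. -/
theorem fd_le_or_of_common {t t' x : Fin (3 * k + 2)} (h : x ∈ arc k t) (h' : x ∈ arc k t') : fd t t' ≤ k ∨ fd t' t ≤ k := by
  rw [mem_arc] at h h'
  rcases le_or_gt (fd t t') (fd t x) with h1 | h1
  · left; omega
  · -- `x` is met strictly before `t'` when walking from `t`
    right
    have e := fd_sub (le_of_lt h1)   -- fd x t' = fd t t' - fd t x
    have hxt : x ≠ t' := by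
      intro hxt; rw [hxt] at h1; exact lt_irrefl _ h1
    have htt : t ≠ t' := by
      intro htt; rw [htt, fd_self] at h1; omega
    have e2 := fd_rev_eq hxt  -- fd t' x = N - fd x t'
    have e3 := fd_rev_eq htt  -- fd t' t = N - fd t t'
    have := fd_lt t t'
    omega

/-- **Connectivity of windows (forward form).**  If `t₀, t ∈ U ω` with `fd t₀ t ≤ k`, then every start on the forward path from
`t₀` to `t` is in `U ω`. [this work] -/
theorem sh_mem_U_of_fd_le {ω : Finset (Fin (3 * k + 2))} {t₀ t : Fin (3 * k + 2)} (h₀ : t₀ ∈ U (k := k) ω)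
    (ht : t ∈ U (k := k) ω) (hd : fd t₀ t ≤ k) {m : ℕ} (hm : m ≤ fd t₀ t) : sh t₀ m ∈ U (k := k) ω := by
  rw [mem_U] at h₀ ht ⊢
  intro x hx
  have hx0 := mem_arc.1 (h₀ hx)
  have hx1 := mem_arc.1 (ht hx)
  rw [mem_arc]
  have hmN : m < 3 * k + 2 := by have := fd_lt t₀ t; omega
  have em : fd t₀ (sh t₀ m) = m := fd_sh t₀ hmN
  rcases le_or_gt m (fd t₀ x) with h1 | h1
  · -- `x` is at or after `sh t₀ m`
    rw [fd_sub (show fd t₀ (sh t₀ m) ≤ fd t₀ x by rw [em]; exact h1), em]; omega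
  · -- `x` strictly before `sh t₀ m`, hence strictly before `t`: then `fd t x` is large
    exfalso
    have h2 : fd t₀ x ≤ fd t₀ t := by omega
    have e := fd_sub h2  -- fd x t = fd t₀ t - fd t₀ x
    have hxt : x ≠ t := by
      intro hxt; rw [hxt] at h1; omega
    have e2 := fd_rev_eq hxt -- fd t x = N - fd x t
    rw [e] at e2
    have := fd_lt t₀ t
    omega

/-! ## Cyclic intervals of starts and the run lemma (FACT 1) -/

/-- The cyclic interval of starts at forward distances `lo, …, hi` from `o`. [this work] -/
def ivl (o : Fin (3 * k + 2)) (lo hi : ℕ) : Finset (Fin (3 * k + 2)) := univ.filter fun x => lo ≤ fd o x ∧ fd o x ≤ hi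

/-- Membership in a cyclic interval. -/
@[simp] theorem mem_ivl {o x : Fin (3 * k + 2)} {lo hi : ℕ} : x ∈ ivl o lo hi ↔ lo ≤ fd o x ∧ fd o x ≤ hi := by simp [ivl]

/-- **The run lemma (FACT 1, geometric part).**  Let `X = ivl o 1 s` (with `s + 1 < 3k+2`) lie inside `C`, while the two starts
just outside `X` — `o` itself and `sh o (s+1)` — are not in `C`.  Then a window inside `C` meeting `X` lies inside `X` (walk from a
common start to any other start of the window along the window; leaving `X` would step on `o` or on `sh o (s+1)`). [this work] -/
theorem U_subset_run {C : Finset (Fin (3 * k + 2))} {o : Fin (3 * k + 2)} {s : ℕ} (hs : s + 1 < 3 * k + 2)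
    (ho : o ∉ C) (hs1 : sh o (s + 1) ∉ C) (ω : Finset (Fin (3 * k + 2))) (hUC : U (k := k) ω ⊆ C)
    (hX : (U (k := k) ω ∩ ivl o 1 s).Nonempty) : U (k := k) ω ⊆ ivl o 1 s := by
  obtain ⟨t₀, ht₀⟩ := hX
  rw [mem_inter] at ht₀
  obtain ⟨h₀U, h₀X⟩ := ht₀
  intro t htU
  -- `t₀` and `t` are within distance `k` one way or the other (or `ω = ∅`, when every start is in the window)
  have hclose : fd t₀ t ≤ k ∨ fd t t₀ ≤ k ∨ ω = ∅ := by
    rcases ω.eq_empty_or_nonempty with h | ⟨x, hx⟩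
    · exact Or.inr (Or.inr h)
    · rcases fd_le_or_of_common ((mem_U.1 h₀U) hx) ((mem_U.1 htU) hx) with h | h
      · exact Or.inl h
      · exact Or.inr (Or.inl h)
  -- path points are in the window
  have hpathF : ∀ m, m ≤ fd t₀ t → (fd t₀ t ≤ k ∨ ω = ∅) → sh t₀ m ∈ U (k := k) ω := by
    intro m hm h
    rcases h with h | h
    · exact sh_mem_U_of_fd_le h₀U htU h hm
    · rw [mem_U, h]; exact empty_subset _
  have hpathB : ∀ m, m ≤ fd t t₀ → (fd t t₀ ≤ k ∨ ω = ∅) → sh t m ∈ U (k := k) ω := by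
    intro m hm h
    rcases h with h | h
    · exact sh_mem_U_of_fd_le htU h₀U h hm
    · rw [mem_U, h]; exact empty_subset _
  rw [mem_ivl] at h₀X ⊢
  rcases hclose with hF | hB | hE
  · -- forward walk from `t₀` to `t`
    have key : ∀ m, m ≤ fd t₀ t → 1 ≤ fd o (sh t₀ m) ∧ fd o (sh t₀ m) ≤ s := by
      intro m
      induction m with
      | zero => intro _; rw [sh_zero]; exact h₀X
      | succ m ih =>
        intro hm
        have ih' := ih (by omega)
        have hmem : sh t₀ (m + 1) ∈ C := hUC (hpathF (m + 1) hm (Or.inl hF))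
        -- `sh t₀ (m+1) = sh (sh t₀ m) 1`, at distance `fd o (sh t₀ m) + 1` from `o`
        have e1 : sh t₀ (m + 1) = sh (sh t₀ m) 1 := by rw [sh_sh]
        have hlt : fd o (sh t₀ m) + 1 < 3 * k + 2 := by omega
        have e2 : fd o (sh (sh t₀ m) 1) = fd o (sh t₀ m) + 1 := by
          have := @fd_add_fd _ _ o (sh t₀ m) (sh (sh t₀ m) 1)
            (by rw [fd_sh _ (show 1 < 3 * k + 2 by omega)]; exact hlt)
          rw [fd_sh _ (show 1 < 3 * k + 2 by omega)] at this
          omega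
        rw [e1, e2]
        refine ⟨by omega, ?_⟩
        by_contra hgt
        have heq : fd o (sh t₀ m) = s := by omega
        -- then `sh (sh t₀ m) 1 = sh o (s+1)` is not in `C`
        have : sh (sh t₀ m) 1 = sh o (s + 1) := by
          rw [← sh_fd o (sh t₀ m), sh_sh, heq]
        rw [e1, this] at hmem
        exact hs1 hmem
    have := key (fd t₀ t) le_rfl
    rwa [sh_fd] at this
  · -- backward walk from `t₀` to `t`: the points `sh t (fd t t₀ - j)`
    have key : ∀ j, j ≤ fd t t₀ → 1 ≤ fd o (sh t (fd t t₀ - j)) ∧ fd o (sh t (fd t t₀ - j)) ≤ s := by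
      intro j
      induction j with
      | zero => intro _; rw [Nat.sub_zero, sh_fd]; exact h₀X
      | succ j ih =>
        intro hj
        have ih' := ih (by omega)
        set y := sh t (fd t t₀ - (j + 1)) with hy
        have hmem : y ∈ C := hUC (hpathB _ (by omega) (Or.inl hB))
        have e1 : sh y 1 = sh t (fd t t₀ - j) := by
          rw [hy, sh_sh]; congr 1; omega
        -- `fd o y + 1 = fd o (sh y 1)` unless `y` is the last point before `o`
        by_cases hyo : fd o y + 1 < 3 * k + 2
        · have e2 : fd o (sh y 1) = fd o y + 1 := by
            have := @fd_add_fd _ _ o y (sh y 1) (by rw [fd_sh _ (show 1 < 3 * k + 2 by omega)]; exact hyo)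
            rw [fd_sh _ (show 1 < 3 * k + 2 by omega)] at this
            omega
          rw [e1] at e2
          refine ⟨?_, by omega⟩
          by_contra hlt
          have h0 : fd o y = 0 := by omega
          rw [fd_eq_zero_iff] at h0
          rw [h0] at ho
          exact ho hmem
        · -- `fd o y = N - 1`: then `sh y 1 = o`, contradicting `1 ≤ fd o (sh y 1)`
          exfalso
          have hval : fd o y = 3 * k + 1 := by have := fd_lt o y; omega
          have : sh y 1 = o := by
            rw [← sh_fd o y, sh_sh, hval]
            exact sh_n o
          rw [e1] at this
          rw [this, fd_self] at ih'
          omega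
    have := key (fd t t₀) le_rfl
    rwa [Nat.sub_self, sh_zero] at this
  · -- `ω = ∅`: the window is everything, contradicting `o ∉ C`
    exfalso
    apply ho
    apply hUC
    rw [mem_U, hE]; exact empty_subset _

end Arc

end SafeCalc

end Summit.CriticalPhenomena.PercolationContinuityZ3.Theorems.SunflowerPartition
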